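import Summits.QuantumFields.YangMills.Theorems.UnitScaleTiltSmoothLiftLoopDefs
import Summits.QuantumFields.YangMills.Theorems.UnitScaleTiltSmoothLiftInterpTools
import HarnessLib

/-!
# Route `UnitScaleTilt`, crux K1 child «MinimiserStabilityRegPr» (stmt-QuantumFields-19200), stub `stub_smoothLift` (G-K1a-2′) — helper P3a:
# TRANSPORT OF THE SMOOTH INTERPOLATION INSIDE A BLOCK, AND THE ALGEBRA OF THE EXPONENTS ALONG A WORD

Fleet seat `ym-ust-19200-p2` (gen 0).  For the consistency `‖V(c) − avg(interp V)(c)‖ = O(|F|² + |∇F|)` of the interpolation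
(`UnitScaleTiltSmoothLiftInterpDefs`) every loop variable of (0.4) is read as a product of exponentials of the model potential
(`UnitScaleTiltSmoothLiftLoopDefs`: `siteAt`, `potAt`, `stepExps`):
* §1 sites at integer offsets (steps, block, centred offsets, exit test, `pot V (siteAt y e) λ = potAt (curv V y) e λ`);
* §2 **`coe_holAt_walk_siteAt`**: inside the cube the transport of `interp V` along `w` from `siteAt y e` is `Π_k exp (stepExps (curv V y) e w)_k`;
* §3 algebra of `stepExps`: concatenation, reversal negates the sum, conjugation of the tensor, Lipschitz dependence on the tensor, axis runs.
[cite: Balaban1987RG1, (0.3)-(0.4) p.252; King1986, (A.5) p.676]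
-/

noncomputable section

open scoped Matrix.Norms.L2Operator BigOperators

namespace Summit.QuantumFields.YangMills.Theorems.SmoothLiftInterp

open Literature.MathematicalPhysics.QuantumFieldTheory.Balaban1983to89
open MatrixLog T4Continuum AveragingRT BlockAveraging BlockAveragingSection BlockAveragingSectionPlaq NormedSpace

variable {P : Params} {j : ℕ}

/-! ## §1 Sites at integer offsets: steps, block, centred offsets, potential -/

section Sites
/-- `siteAt y e + e_μ = siteAt y (e + e_μ)`. [folklore] -/
theorem siteAt_shift (y : Site P (j+1)) (e : Fin P.d → ℤ) (μ : Fin P.d) :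
    (siteAt y e).shift μ = siteAt y (e + Pi.single μ 1) := by
  funext ν
  rw [Site.shift_apply, siteAt_apply, siteAt_apply, siteAt_apply, Pi.add_apply, Pi.single_apply]
  by_cases h : ν = μ
  · subst h; simp only [if_true]; push_cast; ring
  · simp [h]

/-- `siteAt y e − e_μ = siteAt y (e − e_μ)`. [folklore] -/
theorem siteAt_unshift (y : Site P (j+1)) (e : Fin P.d → ℤ) (μ : Fin P.d) :
    (siteAt y e).unshift μ = siteAt y (e - Pi.single μ 1) := by
  funext ν
  rw [Site.unshift_apply, siteAt_apply, siteAt_apply, siteAt_apply, Pi.sub_apply, Pi.single_apply]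
  by_cases h : ν = μ
  · subst h; simp only [if_true]; push_cast; ring
  · simp [h]

/-- An offset in the cube `[−(L−1)/2, (L−1)/2]^d` addresses a site of the block: `siteAt y e = blockSite y ((L−1)/2 + e)`
(standing range). [cite: Balaban1987RG1, (0.3) p.252] -/
theorem siteAt_eq_blockSite (hj : j + 1 ≤ P.m + P.K) (y : Site P (j+1)) (e : Fin P.d → ℤ)
    (he : ∀ ν, -(((P.L - 1) / 2 : ℕ) : ℤ) ≤ e ν ∧ e ν ≤ (((P.L - 1) / 2 : ℕ) : ℤ)) :
    siteAt y e = Site.blockSite y (fun ν => ⟨((((P.L - 1) / 2 : ℕ) : ℤ) + e ν).toNat, by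
      have := he ν; have := AveragingRT.two_mul_half_add_one P; omega⟩) :=
  eq_blockSite_of_near_emb hj y (siteAt y e) e (fun _ => rfl) he

/-- Such a site lies in `B(y)`. [cite: Balaban1987RG1, (0.3) p.252] -/
theorem blockOf_siteAt (hj : j + 1 ≤ P.m + P.K) (y : Site P (j+1)) (e : Fin P.d → ℤ)
    (he : ∀ ν, -(((P.L - 1) / 2 : ℕ) : ℤ) ≤ e ν ∧ e ν ≤ (((P.L - 1) / 2 : ℕ) : ℤ)) : blockOf (siteAt y e) = y := by
  rw [siteAt_eq_blockSite hj y e he]; exact Site.blockOf_blockSite hj y _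

/-- Its in-block label is `(L−1)/2 + e`. [cite: Balaban1987RG1, (0.3) p.252] -/
theorem offset_siteAt (hj : j + 1 ≤ P.m + P.K) (y : Site P (j+1)) (e : Fin P.d → ℤ)
    (he : ∀ ν, -(((P.L - 1) / 2 : ℕ) : ℤ) ≤ e ν ∧ e ν ≤ (((P.L - 1) / 2 : ℕ) : ℤ)) (ν : Fin P.d) :
    (offset (siteAt y e) ν : ℤ) = (((P.L - 1) / 2 : ℕ) : ℤ) + e ν := by
  rw [siteAt_eq_blockSite hj y e he, offset_blockSite hj]
  have := he ν
  simp only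
  omega

/-- Its centred offset is `e`. [cite: Balaban1987RG1, (0.3) p.252] -/
theorem coff_siteAt (hj : j + 1 ≤ P.m + P.K) (y : Site P (j+1)) (e : Fin P.d → ℤ)
    (he : ∀ ν, -(((P.L - 1) / 2 : ℕ) : ℤ) ≤ e ν ∧ e ν ≤ (((P.L - 1) / 2 : ℕ) : ℤ)) (ν : Fin P.d) :
    coff (siteAt y e) ν = ((e ν : ℤ) : ℝ) := by
  unfold coff
  have h := offset_siteAt hj y e he ν
  have h' : ((offset (siteAt y e) ν : ℤ) : ℝ) = ((((P.L - 1) / 2 : ℕ) : ℤ) : ℝ) + ((e ν : ℤ) : ℝ) := by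
    rw [h]; push_cast; ring
  have h1 : ((offset (siteAt y e) ν : ℤ) : ℝ) = (offset (siteAt y e) ν : ℝ) := by norm_cast
  have h2 : ((((P.L - 1) / 2 : ℕ) : ℤ) : ℝ) = (((P.L - 1) / 2 : ℕ) : ℝ) := by norm_cast
  rw [h1, h2] at h'
  linarith

/-- The bond `⟨siteAt y e, μ⟩` exits the block iff `e_μ = (L−1)/2`. [cite: Balaban1987RG1, (0.3) p.252] -/
theorem exitsBlock_siteAt_iff (hj : j + 1 ≤ P.m + P.K) (y : Site P (j+1)) (e : Fin P.d → ℤ)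
    (he : ∀ ν, -(((P.L - 1) / 2 : ℕ) : ℤ) ≤ e ν ∧ e ν ≤ (((P.L - 1) / 2 : ℕ) : ℤ)) (μ : Fin P.d) :
    ExitsBlock (⟨siteAt y e, μ⟩ : PBond P j) ↔ e μ = (((P.L - 1) / 2 : ℕ) : ℤ) := by
  rw [exitsBlock_iff]
  show offset (siteAt y e) μ = P.L - 1 ↔ _
  have h := offset_siteAt hj y e he μ
  have hL := AveragingRT.two_mul_half_add_one P
  have := he μ
  omega

/-- **THE POTENTIAL AT A SITE OF THE BLOCK IS THE MODEL POTENTIAL AT ITS OFFSET**: `pot V (siteAt y e) λ = potAt (curv V y) e λ`.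
[cite: King1986, (A.5) p.676] -/
theorem pot_siteAt (hj : j + 1 ≤ P.m + P.K) (V : GaugeField P (j+1) (Matrix.specialUnitaryGroup (Fin 2) ℂ)) (y : Site P (j+1))
    (e : Fin P.d → ℤ) (he : ∀ ν, -(((P.L - 1) / 2 : ℕ) : ℤ) ≤ e ν ∧ e ν ≤ (((P.L - 1) / 2 : ℕ) : ℤ)) (μ : Fin P.d) :
    pot V (siteAt y e) μ = potAt P (curv V y) e μ := by
  unfold pot potAt
  rw [blockOf_siteAt hj y e he]
  congr 1
  exact Finset.sum_congr rfl fun ρ _ => by rw [coff_siteAt hj y e he]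
end Sites

/-! ## §2 Transport of the interpolation along a word inside one block: a product of exponentials of the model potential -/

section Walk
/-- Prefix positions of the tail of a word: position `k` of `w` from `e + δ(l)` is position `k + 1` of `l :: w` from `e`. [folklore] -/
theorem netDisp_take_succ_cons {d : ℕ} (l : Letter d) (w : List (Letter d)) (k : ℕ) (ν : Fin d) :
    netDisp ((l :: w).take (k + 1)) ν = (if l.1 = ν then (if l.2 then (1 : ℤ) else -1) else 0) + netDisp (w.take k) ν := by
  rw [List.take_succ_cons, netDisp_cons]

/-- **TRANSPORT INSIDE A BLOCK IS A PRODUCT OF EXPONENTIALS OF THE MODEL POTENTIAL.**  If every prefix of the word `w` walked from the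
offset `e` stays in the cube `[−(L−1)/2, (L−1)/2]^d` of the block `B(y)`, then the transport of `interp V` along `w` from `siteAt y e`
is `Π_k exp(±potAt (curv V y) (source_k) λ_k)` — the ordered product of the exponentials of `stepExps (curv V y) e w` (no bond of the
walk exits the block; on such bonds `interp V = exp(pot)`, `UnitScaleTiltSmoothLiftInterpDefs`). [cite: King1986, (A.5) p.676] -/
theorem coe_holAt_walk_siteAt (hj : j + 1 ≤ P.m + P.K) (V : GaugeField P (j+1) (Matrix.specialUnitaryGroup (Fin 2) ℂ))
    (y : Site P (j+1)) : ∀ (w : List (Letter P.d)) (e : Fin P.d → ℤ),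
    (∀ (k : ℕ) (ν : Fin P.d), -(((P.L - 1) / 2 : ℕ) : ℤ) ≤ e ν + netDisp (w.take k) ν ∧
      e ν + netDisp (w.take k) ν ≤ (((P.L - 1) / 2 : ℕ) : ℤ)) →
    ((holAt (interp V) (walk (siteAt y e) w) : Matrix.specialUnitaryGroup (Fin 2) ℂ) : Matrix (Fin 2) (Fin 2) ℂ) =
      ((stepExps P (curv V y) e w).map exp).prod
  | [], e, _ => by simp [walk, holAt_nil]
  | (μ, true) :: w, e, hbox => by
    letI : NormedAlgebra ℚ (Matrix (Fin 2) (Fin 2) ℂ) := NormedAlgebra.restrictScalars ℚ ℂ _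
    have he : ∀ ν, -(((P.L - 1) / 2 : ℕ) : ℤ) ≤ e ν ∧ e ν ≤ (((P.L - 1) / 2 : ℕ) : ℤ) := fun ν => by
      have := hbox 0 ν; simpa [netDisp] using this
    have he' : ∀ (k : ℕ) (ν : Fin P.d), -(((P.L - 1) / 2 : ℕ) : ℤ) ≤ (e + Pi.single μ 1 : Fin P.d → ℤ) ν + netDisp (w.take k) ν ∧
        (e + Pi.single μ 1 : Fin P.d → ℤ) ν + netDisp (w.take k) ν ≤ (((P.L - 1) / 2 : ℕ) : ℤ) := fun k ν => by
      have h := hbox (k + 1) ν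
      rw [netDisp_take_succ_cons] at h
      rw [Pi.add_apply, Pi.single_apply]
      by_cases hν : ν = μ
      · subst hν; simp only [if_true] at h ⊢; constructor <;> omega
      · simp only [if_neg hν, if_neg (Ne.symm hν)] at h ⊢; simpa using h
    have hnotexit : ¬ ExitsBlock (⟨siteAt y e, μ⟩ : PBond P j) := by
      rw [exitsBlock_siteAt_iff hj y e he]
      have h := (he' 0 μ).2
      simp [netDisp] at h
      omega
    rw [walk, holAt_cons, stepExps_cons_true, List.map_cons, List.prod_cons]
    simp only [if_true, Submonoid.coe_mul]
    rw [coe_interp_of_not_exits V hnotexit, siteAt_shift, coe_holAt_walk_siteAt hj V y w _ he']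
    simp only [pot_siteAt hj V y e he]
  | (μ, false) :: w, e, hbox => by
    letI : NormedAlgebra ℚ (Matrix (Fin 2) (Fin 2) ℂ) := NormedAlgebra.restrictScalars ℚ ℂ _
    have he : ∀ ν, -(((P.L - 1) / 2 : ℕ) : ℤ) ≤ e ν ∧ e ν ≤ (((P.L - 1) / 2 : ℕ) : ℤ) := fun ν => by
      have := hbox 0 ν; simpa [netDisp] using this
    have he' : ∀ (k : ℕ) (ν : Fin P.d), -(((P.L - 1) / 2 : ℕ) : ℤ) ≤ (e - Pi.single μ 1 : Fin P.d → ℤ) ν + netDisp (w.take k) ν ∧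
        (e - Pi.single μ 1 : Fin P.d → ℤ) ν + netDisp (w.take k) ν ≤ (((P.L - 1) / 2 : ℕ) : ℤ) := fun k ν => by
      have h := hbox (k + 1) ν
      rw [netDisp_take_succ_cons] at h
      rw [Pi.sub_apply, Pi.single_apply]
      by_cases hν : ν = μ
      · subst hν; simp only [if_true, Bool.false_eq_true, if_false] at h ⊢; constructor <;> omega
      · simp only [if_neg hν, if_neg (Ne.symm hν)] at h ⊢; simpa using h
    have he'' : ∀ ν, -(((P.L - 1) / 2 : ℕ) : ℤ) ≤ (e - Pi.single μ 1 : Fin P.d → ℤ) ν ∧ (e - Pi.single μ 1 : Fin P.d → ℤ) ν ≤ (((P.L - 1) / 2 : ℕ) : ℤ) :=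
      fun ν => by have := he' 0 ν; simpa [netDisp] using this
    have hnotexit : ¬ ExitsBlock (⟨siteAt y (e - Pi.single μ 1), μ⟩ : PBond P j) := by
      rw [exitsBlock_siteAt_iff hj y _ he'', Pi.sub_apply, Pi.single_apply, if_pos rfl]
      have h := (he μ).2
      omega
    rw [walk, holAt_cons, stepExps_cons_false, List.map_cons, List.prod_cons]
    simp only [Bool.false_eq_true, if_false, Submonoid.coe_mul, coe_inv_su2]
    rw [siteAt_unshift, coe_interp_of_not_exits V hnotexit,
      star_exp_of_mem_lie (pot_mem_lie V _ _), coe_holAt_walk_siteAt hj V y w _ he']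
    simp only [pot_siteAt hj V y _ he'']
end Walk

/-! ## §3 Algebra of the exponent lists: concatenation, reversal, conjugation, dependence on the curvature tensor, axis runs -/

section Exponents
variable (P)

/-- The potential is additive in the offset: `potAt F (e + e_κ) λ = potAt F e λ + F_{κλ}/(2L²)`. [folklore] -/
theorem potAt_add_single (F : Fin P.d → Fin P.d → Matrix (Fin 2) (Fin 2) ℂ) (e : Fin P.d → ℤ) (κ μ : Fin P.d) :
    potAt P F (e + Pi.single κ 1) μ = potAt P F e μ + (1 / (2 * (P.L : ℝ) ^ 2)) • F κ μ := by
  unfold potAt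
  rw [← smul_add]
  congr 1
  have : ∀ ρ, (((e + Pi.single κ 1 : Fin P.d → ℤ) ρ : ℤ) : ℝ) • F ρ μ = ((e ρ : ℤ) : ℝ) • F ρ μ + (if ρ = κ then F ρ μ else 0) := by
    intro ρ
    rw [Pi.add_apply, Pi.single_apply]
    by_cases h : ρ = κ
    · subst h; simp [add_smul]
    · simp [h]
  simp_rw [this, Finset.sum_add_distrib, Finset.sum_ite_eq' Finset.univ κ, if_pos (Finset.mem_univ κ)]

/-- … and `potAt F (e − e_κ) λ = potAt F e λ − F_{κλ}/(2L²)`. [folklore] -/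
theorem potAt_sub_single (F : Fin P.d → Fin P.d → Matrix (Fin 2) (Fin 2) ℂ) (e : Fin P.d → ℤ) (κ μ : Fin P.d) :
    potAt P F (e - Pi.single κ 1) μ = potAt P F e μ - (1 / (2 * (P.L : ℝ) ^ 2)) • F κ μ := by
  have h := potAt_add_single P F (e - Pi.single κ 1) κ μ
  rw [sub_add_cancel] at h
  rw [h]; abel

/-- On the axis of direction `μ` the `μ`-potential vanishes when `F_{μμ} = 0`. [folklore] -/
theorem potAt_axis (F : Fin P.d → Fin P.d → Matrix (Fin 2) (Fin 2) ℂ) {μ : Fin P.d} (hF : F μ μ = 0) {e : Fin P.d → ℤ}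
    (he : ∀ ρ, ρ ≠ μ → e ρ = 0) : potAt P F e μ = 0 := by
  unfold potAt
  rw [Finset.sum_eq_zero, smul_zero]
  intro ρ _
  by_cases h : ρ = μ
  · subst h; rw [hF, smul_zero]
  · rw [he ρ h]; simp

/-- Exponents of a concatenation. [folklore] -/
theorem stepExps_append (F : Fin P.d → Fin P.d → Matrix (Fin 2) (Fin 2) ℂ) : ∀ (w₁ w₂ : List (Letter P.d)) (e : Fin P.d → ℤ),
    stepExps P F e (w₁ ++ w₂) = stepExps P F e w₁ ++ stepExps P F (e + fun ν => netDisp w₁ ν) w₂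
  | [], w₂, e => by
    have h : (e + fun ν => netDisp ([] : List (Letter P.d)) ν) = e := by funext ν; simp [netDisp]
    rw [h]; rfl
  | (μ, true) :: w₁, w₂, e => by
    have hoff : ((e + Pi.single μ 1 : Fin P.d → ℤ) + fun ν => netDisp w₁ ν) = e + fun ν => netDisp ((μ, true) :: w₁) ν := by
      funext ν
      simp only [Pi.add_apply, netDisp_cons, Pi.single_apply, if_true]
      by_cases h : ν = μ
      · subst h; simp; ring
      · simp [h, Ne.symm h]
    rw [List.cons_append, stepExps_cons_true, stepExps_cons_true, stepExps_append F w₁ w₂, List.cons_append, hoff]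
  | (μ, false) :: w₁, w₂, e => by
    have hoff : ((e - Pi.single μ 1 : Fin P.d → ℤ) + fun ν => netDisp w₁ ν) = e + fun ν => netDisp ((μ, false) :: w₁) ν := by
      funext ν
      simp only [Pi.add_apply, Pi.sub_apply, netDisp_cons, Pi.single_apply, Bool.false_eq_true, if_false]
      by_cases h : ν = μ
      · subst h; simp; ring
      · simp [h, Ne.symm h]
    rw [List.cons_append, stepExps_cons_false, stepExps_cons_false, stepExps_append F w₁ w₂, List.cons_append, hoff]

/-- **REVERSAL NEGATES THE SUM OF THE EXPONENTS**: the word `w` traversed backwards from its endpoint reads the same bonds with opposite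
signs. [folklore] -/
theorem sum_stepExps_wordRev (F : Fin P.d → Fin P.d → Matrix (Fin 2) (Fin 2) ℂ) : ∀ (w : List (Letter P.d)) (e : Fin P.d → ℤ),
    (stepExps P F (e + fun ν => netDisp w ν) (wordRev w)).sum = -(stepExps P F e w).sum
  | [], e => by simp [wordRev]
  | (μ, b) :: w, e => by
    have hstart : (e + fun ν => netDisp ((μ, b) :: w) ν) = (e + fun ν => (if μ = ν then (if b then (1:ℤ) else -1) else 0)) + fun ν => netDisp w ν := by
      funext ν; simp only [Pi.add_apply, netDisp_cons]; ring
    rw [wordRev_cons, stepExps_append, hstart, List.sum_append, sum_stepExps_wordRev F w]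
    have hend : ((e + fun ν => (if μ = ν then (if b then (1:ℤ) else -1) else 0)) + fun ν => netDisp w ν) + (fun ν => netDisp (wordRev w) ν) =
        e + fun ν => (if μ = ν then (if b then (1:ℤ) else -1) else 0) := by
      funext ν; simp only [Pi.add_apply, netDisp_wordRev]; ring
    rw [hend]
    cases b
    · -- backward letter: its flip is forward, read at `e − e_μ`
      have hflip : Letter.flip ((μ, false) : Letter P.d) = (μ, true) := rfl
      have hpos : (e + fun ν => (if μ = ν then (if false then (1:ℤ) else -1) else 0)) = e - Pi.single μ 1 := by
        funext ν; simp only [Pi.add_apply, Pi.sub_apply, Pi.single_apply, Bool.false_eq_true, if_false]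
        by_cases h : ν = μ
        · subst h; simp; ring
        · simp [h, Ne.symm h]
      rw [hflip, hpos, stepExps_cons_true, stepExps_nil, stepExps_cons_false, List.sum_cons, List.sum_cons, List.sum_nil]
      abel
    · have hflip : Letter.flip ((μ, true) : Letter P.d) = (μ, false) := rfl
      have hpos : (e + fun ν => (if μ = ν then (if true then (1:ℤ) else -1) else 0)) = e + Pi.single μ 1 := by
        funext ν; simp only [Pi.add_apply, Pi.single_apply, if_true]
        by_cases h : ν = μ
        · subst h; simp
        · simp [h, Ne.symm h]
      rw [hflip, hpos, stepExps_cons_false, stepExps_nil, stepExps_cons_true, List.sum_cons, List.sum_cons, List.sum_nil,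
        add_sub_cancel_right]
      abel

/-- Conjugating the curvature tensor conjugates every exponent. [folklore] -/
theorem stepExps_conj (F : Fin P.d → Fin P.d → Matrix (Fin 2) (Fin 2) ℂ) (U : Matrix (Fin 2) (Fin 2) ℂ) :
    ∀ (w : List (Letter P.d)) (e : Fin P.d → ℤ),
    stepExps P (fun ρ μ => U * F ρ μ * star U) e w = (stepExps P F e w).map (fun X => U * X * star U)
  | [], e => by simp
  | (μ, true) :: w, e => by
    rw [stepExps_cons_true, stepExps_cons_true, List.map_cons, stepExps_conj F U w]
    congr 1
    unfold potAt
    rw [Matrix.mul_smul, Matrix.smul_mul, Finset.mul_sum, Finset.sum_mul]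
    congr 1
    exact Finset.sum_congr rfl fun ρ _ => by rw [Matrix.mul_smul, Matrix.smul_mul]
  | (μ, false) :: w, e => by
    rw [stepExps_cons_false, stepExps_cons_false, List.map_cons, stepExps_conj F U w]
    congr 1
    unfold potAt
    rw [mul_neg, neg_mul, Matrix.mul_smul, Matrix.smul_mul, Finset.mul_sum, Finset.sum_mul]
    congr 2
    exact Finset.sum_congr rfl fun ρ _ => by rw [Matrix.mul_smul, Matrix.smul_mul]

/-- `U (Π_k e^{X_k}) U* = Π_k e^{U X_k U*}` for `U ∈ SU(2)`. [folklore] -/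
theorem conj_prod_map_exp (U : Matrix.specialUnitaryGroup (Fin 2) ℂ) : ∀ (l : List (Matrix (Fin 2) (Fin 2) ℂ)),
    ((U : Matrix.specialUnitaryGroup (Fin 2) ℂ) : Matrix (Fin 2) (Fin 2) ℂ) * (l.map exp).prod *
        star ((U : Matrix.specialUnitaryGroup (Fin 2) ℂ) : Matrix (Fin 2) (Fin 2) ℂ) =
      ((l.map fun X => ((U : Matrix.specialUnitaryGroup (Fin 2) ℂ) : Matrix (Fin 2) (Fin 2) ℂ) * X *
        star ((U : Matrix.specialUnitaryGroup (Fin 2) ℂ) : Matrix (Fin 2) (Fin 2) ℂ)).map exp).prod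
  | [] => by
    simp only [List.map_nil, List.prod_nil, mul_one]
    exact Matrix.mem_unitaryGroup_iff.1 (Matrix.mem_specialUnitaryGroup_iff.1 U.2).1
  | X :: l => by
    have hUU : star ((U : Matrix.specialUnitaryGroup (Fin 2) ℂ) : Matrix (Fin 2) (Fin 2) ℂ) *
        ((U : Matrix.specialUnitaryGroup (Fin 2) ℂ) : Matrix (Fin 2) (Fin 2) ℂ) = 1 :=
      Matrix.mem_unitaryGroup_iff'.1 (Matrix.mem_specialUnitaryGroup_iff.1 U.2).1
    rw [List.map_cons, List.prod_cons, List.map_cons, List.map_cons, List.prod_cons, ← conj_prod_map_exp U l, ← conj_exp]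
    set u := ((U : Matrix.specialUnitaryGroup (Fin 2) ℂ) : Matrix (Fin 2) (Fin 2) ℂ)
    calc u * (exp X * (l.map exp).prod) * star u = u * exp X * (star u * u) * (l.map exp).prod * star u := by
          rw [hUU]; noncomm_ring
      _ = u * exp X * star u * (u * (l.map exp).prod * star u) := by noncomm_ring

/-- **THE EXPONENTS DEPEND LIPSCHITZ-CONTINUOUSLY ON THE CURVATURE TENSOR**: if `‖F_{ρλ} − F′_{ρλ}‖ ≤ δ` and every prefix position
is bounded by `M`, the sums differ by at most `|w|·d·M·δ/(2L²)`. [folklore] -/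
theorem norm_sum_stepExps_sub_le (F F' : Fin P.d → Fin P.d → Matrix (Fin 2) (Fin 2) ℂ) {δ M : ℝ} (hM : 0 ≤ M)
    (hδ : ∀ ρ μ, ‖F ρ μ - F' ρ μ‖ ≤ δ) : ∀ (w : List (Letter P.d)) (e : Fin P.d → ℤ),
    (∀ (k : ℕ) (ν : Fin P.d), |((e ν + netDisp (w.take k) ν : ℤ) : ℝ)| ≤ M) →
    ‖(stepExps P F e w).sum - (stepExps P F' e w).sum‖ ≤ w.length * ((P.d : ℝ) * M * δ / (2 * (P.L : ℝ) ^ 2))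
  | [], e, _ => by simp
  | (μ, b) :: w, e, hbox => by
    have hδ0 : 0 ≤ δ := (norm_nonneg _).trans (hδ μ μ)
    -- the potential difference at one offset of size `≤ M`
    have hpot : ∀ e' : Fin P.d → ℤ, (∀ ν, |((e' ν : ℤ) : ℝ)| ≤ M) →
        ‖potAt P F e' μ - potAt P F' e' μ‖ ≤ (P.d : ℝ) * M * δ / (2 * (P.L : ℝ) ^ 2) := by
      intro e' he'
      unfold potAt
      rw [← smul_sub, ← Finset.sum_sub_distrib, norm_smul, Real.norm_of_nonneg (by positivity)]
      have hs : ‖∑ ρ : Fin P.d, (((e' ρ : ℤ) : ℝ) • F ρ μ - ((e' ρ : ℤ) : ℝ) • F' ρ μ)‖ ≤ (P.d : ℝ) * (M * δ) := by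
        calc _ ≤ ∑ ρ : Fin P.d, ‖((e' ρ : ℤ) : ℝ) • F ρ μ - ((e' ρ : ℤ) : ℝ) • F' ρ μ‖ := norm_sum_le _ _
          _ ≤ ∑ _ρ : Fin P.d, M * δ := Finset.sum_le_sum fun ρ _ => by
              rw [← smul_sub, norm_smul, Real.norm_eq_abs]
              exact mul_le_mul (he' ρ) (hδ ρ μ) (norm_nonneg _) hM
          _ = (P.d : ℝ) * (M * δ) := by rw [Finset.sum_const, Finset.card_univ, Fintype.card_fin, nsmul_eq_mul]
      calc 1 / (2 * (P.L : ℝ) ^ 2) * ‖∑ ρ : Fin P.d, (((e' ρ : ℤ) : ℝ) • F ρ μ - ((e' ρ : ℤ) : ℝ) • F' ρ μ)‖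
          ≤ 1 / (2 * (P.L : ℝ) ^ 2) * ((P.d : ℝ) * (M * δ)) := by gcongr
        _ = _ := by ring
    have hlen : (((μ, b) :: w).length : ℝ) = w.length + 1 := by push_cast [List.length_cons]; ring
    cases b
    · have he' : ∀ ν, |(((e - Pi.single μ 1 : Fin P.d → ℤ) ν : ℤ) : ℝ)| ≤ M := fun ν => by
        have h := hbox 1 ν
        rw [netDisp_take_succ_cons] at h
        simp only [List.take_zero, Bool.false_eq_true, if_false] at h
        have h0 : netDisp ([] : List (Letter P.d)) ν = 0 := by simp [netDisp]
        rw [h0, add_zero] at h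
        rw [Pi.sub_apply, Pi.single_apply]
        by_cases hν : ν = μ
        · subst hν; simp only [if_true] at h ⊢; rwa [sub_eq_add_neg]
        · simp only [if_neg hν, if_neg (Ne.symm hν), add_zero, sub_zero] at h ⊢; exact h
      have htail : ∀ (k : ℕ) (ν : Fin P.d), |(((e - Pi.single μ 1 : Fin P.d → ℤ) ν + netDisp (w.take k) ν : ℤ) : ℝ)| ≤ M := fun k ν => by
        have h := hbox (k + 1) ν
        rw [netDisp_take_succ_cons] at h
        rw [Pi.sub_apply, Pi.single_apply]
        by_cases hν : ν = μ
        · subst hν; simp only [if_true, Bool.false_eq_true, if_false] at h ⊢; rwa [sub_eq_add_neg, add_assoc]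
        · simp only [if_neg hν, if_neg (Ne.symm hν), zero_add, sub_zero] at h ⊢; exact h
      rw [stepExps_cons_false, stepExps_cons_false, List.sum_cons, List.sum_cons, hlen]
      have h1 := hpot _ he'
      have h2 := norm_sum_stepExps_sub_le F F' hM hδ w _ htail
      calc _ = ‖-(potAt P F (e - Pi.single μ 1) μ - potAt P F' (e - Pi.single μ 1) μ) +
            ((stepExps P F (e - Pi.single μ 1) w).sum - (stepExps P F' (e - Pi.single μ 1) w).sum)‖ := by congr 1; abel
        _ ≤ ‖potAt P F (e - Pi.single μ 1) μ - potAt P F' (e - Pi.single μ 1) μ‖ +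
            ‖(stepExps P F (e - Pi.single μ 1) w).sum - (stepExps P F' (e - Pi.single μ 1) w).sum‖ :=
            (norm_add_le _ _).trans (by rw [norm_neg])
        _ ≤ _ := by linarith
    · have he' : ∀ ν, |((e ν : ℤ) : ℝ)| ≤ M := fun ν => by
        have h := hbox 0 ν; simpa [netDisp] using h
      have htail : ∀ (k : ℕ) (ν : Fin P.d), |(((e + Pi.single μ 1 : Fin P.d → ℤ) ν + netDisp (w.take k) ν : ℤ) : ℝ)| ≤ M := fun k ν => by
        have h := hbox (k + 1) ν
        rw [netDisp_take_succ_cons] at h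
        rw [Pi.add_apply, Pi.single_apply]
        by_cases hν : ν = μ
        · subst hν; simp only [if_true] at h ⊢; rwa [add_assoc]
        · simp only [if_neg hν, if_neg (Ne.symm hν), zero_add, add_zero] at h ⊢; exact h
      rw [stepExps_cons_true, stepExps_cons_true, List.sum_cons, List.sum_cons, hlen]
      have h1 := hpot _ he'
      have h2 := norm_sum_stepExps_sub_le F F' hM hδ w _ htail
      calc _ = ‖(potAt P F e μ - potAt P F' e μ) + ((stepExps P F (e + Pi.single μ 1) w).sum - (stepExps P F' (e + Pi.single μ 1) w).sum)‖ := by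
            congr 1; abel
        _ ≤ ‖potAt P F e μ - potAt P F' e μ‖ + ‖(stepExps P F (e + Pi.single μ 1) w).sum - (stepExps P F' (e + Pi.single μ 1) w).sum‖ :=
            norm_add_le _ _
        _ ≤ _ := by linarith

/-- **AXIS RUNS**: `t` forward steps `+e_μ` from `e` read `t` copies of `potAt F e μ` when `F_{μμ} = 0`. [folklore] -/
theorem sum_stepExps_replicate_true (F : Fin P.d → Fin P.d → Matrix (Fin 2) (Fin 2) ℂ) {μ : Fin P.d} (hF : F μ μ = 0) :
    ∀ (t : ℕ) (e : Fin P.d → ℤ), (stepExps P F e (List.replicate t (μ, true))).sum = (t : ℝ) • potAt P F e μ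
  | 0, e => by simp
  | t + 1, e => by
    rw [List.replicate_succ, stepExps_cons_true, List.sum_cons, sum_stepExps_replicate_true F hF t, potAt_add_single, hF,
      smul_zero, add_zero]
    push_cast
    rw [add_smul, one_smul, add_comm]

/-- … and `t` backward steps read `−t` copies. [folklore] -/
theorem sum_stepExps_replicate_false (F : Fin P.d → Fin P.d → Matrix (Fin 2) (Fin 2) ℂ) {μ : Fin P.d} (hF : F μ μ = 0) :
    ∀ (t : ℕ) (e : Fin P.d → ℤ), (stepExps P F e (List.replicate t (μ, false))).sum = -((t : ℝ) • potAt P F e μ)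
  | 0, e => by simp
  | t + 1, e => by
    rw [List.replicate_succ, stepExps_cons_false, List.sum_cons, sum_stepExps_replicate_false F hF t, potAt_sub_single, hF,
      smul_zero, sub_zero]
    push_cast
    rw [add_smul, one_smul]
    abel
end Exponents

end Summit.QuantumFields.YangMills.Theorems.SmoothLiftInterp

end
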